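import Mathlib
import Literature.Analysis.FluidPDE.Tao2016AveragedNS.ShiftSetCascadeFlows
import Literature.Analysis.FluidPDE.Tao2016AveragedNS.ShiftSetCascadeFlux
import Summits.NavierStokesRegularity.NavierStokesRegularity.Theorems.TaoLadderRungTwoFlatCertificateGlueWrapperOn
import Summits.NavierStokesRegularity.NavierStokesRegularity.Theorems.TaoLadderRungTwoFlatCertificateGlueStaticsWakeOn
import Summits.NavierStokesRegularity.NavierStokesRegularity.Theorems.TaoLadderRungTwoFlatCertificateGlueStaticsQuietOn
import Summits.NavierStokesRegularity.NavierStokesRegularity.Theorems.TaoLadderRungTwoFlatCertificateGlueBranchOn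
import Summits.NavierStokesRegularity.NavierStokesRegularity.Theorems.TaoLadderRungTwoFlatCertificateBlowupOn
import Summits.NavierStokesRegularity.NavierStokesRegularity.Theorems.TaoLadderRungTwoFlatGappedFrontRobustDeviationOn
import HarnessLib

/-!
# Certificate glue on a shift set `𝕊`, XIII-b — the S-SIDE TWIN, BRANCH FORM: the deciding crux K_A₂(64) of route TaoLadderRungThree
  (`DyadicGapCertificateV2R64`, item stmt-NavierStokesRegularity-24295) FROM DATA, NINE SCALAR CHECKS, `hinside` AND A
  BRANCH CERTIFICATE (glue X-c), for ANY table of the class `E(S, 64)` at the dyadic scale ratio `ε₀ = 1`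
  (helper for item stmt-NavierStokesRegularity-24295; cell harvest/h2-tao-ladder, p1 g14)

`dyadicGapCertificateV2R64_of_branchChecks`: as glue XIII (`…_of_meshChecks`, p608371) but with the two dynamical
clauses discharged by the BRANCH layer (glue X-c: per start box rough enclosures up to `c`, section sign at two
times, readout at the states reached on the section — the export shape of theory-1 T-34). Original description: the general window-certificate glue (`gapData₂On_pgw_of_windowCertificate`,
glue VII, any nearest-neighbour slot-closed `𝕊 ∌ (1,1,1)`) instantiated on Tao's one-way shift set `S` with `m = 4` modes
and `ε₀ = 1`, the `∀`-statics discharged by glue VIII (geometric reference wake `Cb·2^{γ|j|}`, flow wake `2(Zb + r/Cw)`,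
two-level quiet profile, piecewise-Gaussian weights, `Ka ≥ 4`), and the two dynamical clauses discharged by the MESH layer
(glue X / X-b: one-step enclosures `StepCert` along a mesh, hulls in the open `M`-box, section crossing in a window of
short steps, static readout on `Hull j ∩ {sec = lev}`). CONCLUSION: the statement of item 24295 VERBATIM
(`∃ σ i₀ α X₀ Z w …, InTableClass 64 α ∧ X₀ i₀ ≠ 0 ∧ GapData₂ σ 1 i₀ α … ∧ thin tail`). Hence a window certificate of this
shape for ONE 64-comparable four-mode table on `S` at `ε₀ = 1` (intended: p2's D64, NUM-4b row S2-D64) is, once its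
per-step enclosures are established, a proof of K_A₂(64) — and, through `noGlobalCascade_of_gapData₂`, of blow-up of that
table at scale ratio `2`.

HONEST FRAMING: Tao-type MODEL lattice; every hypothesis (checks, `hinside`, mesh certificate) is a HYPOTHESIS — no
certificate instance exists in the tree, nothing is certified here and item 24295 is NOT closed by this file; nothing here
is a statement about the Navier–Stokes equations.
-/

noncomputable section

-- the sub-problem namespace repeats the summit name by design (D-0017)
set_option linter.dupNamespace false

namespace Summit.NavierStokesRegularity.NavierStokesRegularity.Theorems

open Set Filter Topology MeasureTheory intervalIntegral Literature.Analysis.FluidPDE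
  Literature.Analysis.FluidPDE.TaoCascade
open Summit.NavierStokesRegularity.NavierStokesRegularity.Theorems.GappedFrontRobustOn

namespace CertificateGlueOn

/-- **K_A₂(64) FROM DATA, NINE SCALAR CHECKS, `hinside` AND A BRANCH CERTIFICATE** (see the module docstring).
[cite: Tao2016AveragedNS, §6.3–6.4 Props. 6.4–6.5 (statement shape of a renormalisation certificate); route TaoLadderRungThree, crux K_A₂(64)] -/
theorem dyadicGapCertificateV2R64_of_branchChecks {α : Fin 4 → Fin 4 → Fin 4 → ℤ × ℤ × ℤ → ℝ}
    (hα : InTableClassOn shiftSet 64 α) {i₀ : Fin 4} {X₀ : Fin 4 → ℝ} (hX₀ : X₀ i₀ ≠ 0)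
    -- window, weights, radius, contraction, exponents, clocks, slack
    {Kb Ka : ℤ} (hKb : 0 ≤ Kb) (hKa : 4 ≤ Ka) {Core : (Fin 4 → ℤ → ℝ) → Prop} {M w : ℤ → ℝ}
    {r ρ θ₀ θ c₀ c σ : ℝ} (hr : 0 < r) (hρ : 0 ≤ ρ) (hρ1 : ρ < 1) (hθ₀ : 0 ≤ θ₀) (hθ₀θ : θ₀ < θ)
    (hθ : θ ≤ 1 / 2) (hc₀ : 0 < c₀) (hc₀c : c₀ < c) (hσ : 0 < σ)
    {Mmax : ℝ} (hMmax : ∀ k, -Kb ≤ k → k ≤ Ka → M k ≤ Mmax)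
    (hcore : ∀ z z' : Fin 4 → ℤ → ℝ, (∀ i k, -Kb ≤ k → k ≤ Ka → z i k = z' i k) → Core z → Core z')
    (hdatum : Core (datumState i₀ X₀))
    -- the piecewise-Gaussian weight
    {Cw b : ℝ} (hCw : 1 ≤ Cw) (hb : 1 / 2 ≤ b)
    (hwp : ∀ k : ℤ, 0 ≤ k → w k = Cw * (2 : ℝ) ^ ((k : ℝ) ^ 2 / 2 + b * k))
    (hwn : ∀ k : ℤ, k < 0 → w k = Cw)
    -- wake side: geometric reference envelope and its two scalar checks
    {Zb Zf : ℤ → ℝ} {Cb γ : ℝ} (hCb : 0 < Cb) (hγ0 : 0 ≤ γ) (hγ1 : γ ≤ 1)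
    (hZb : ∀ j : ℤ, Zb j = Cb * (1 + (1 : ℝ)) ^ (-(γ * j)))
    (hZf : ∀ j : ℤ, Zf j = 2 * (Zb j + r / Cw)) (hMZf : M (-Kb) ≤ Zf (-Kb))
    (checkB₁ : 32 * c * 64 * (1 + (1 : ℝ)) ^ (2 * γ) *
      ((1 + (1 : ℝ)) ^ ((5 : ℝ) * ((-Kb - 1 : ℤ) : ℝ) / 2) * (Zb (-Kb - 1) + r / Cw)) ≤ 1)
    (checkB₂ : (1 + (1 : ℝ)) ^ θ₀ * (Zb (-Kb - 1) + r / Cw +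
      32 * c * 64 * (1 + (1 : ℝ)) ^ (2 * γ) *
        ((1 + (1 : ℝ)) ^ ((5 : ℝ) * ((-Kb - 1 : ℤ) : ℝ) / 2) * (Zb (-Kb - 1) + r / Cw) ^ 2)) ≤ Zb (-Kb - 1 - 1))
    -- quiet side: two-level profile and its scalar checks
    {ν : ℤ → ℝ} {ν₀ ν₁ ϑ : ℝ} (hcoreTop : ∀ z, Core z → ∀ i, 4 * (w Ka * |z i Ka|) ≤ r)
    (hνKa : ν Ka = ν₀) (hνhi : ∀ K : ℤ, Ka + 1 ≤ K → ν K = ν₁) (hν₀ : 0 ≤ ν₀) (hν₁ : 0 ≤ ν₁)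
    (hMν : M Ka ≤ ν₀ * r / w (Ka - 1))
    (checkA₁ : (1 + (1 : ℝ)) ^ ((5 : ℝ) * ((Ka + 1 : ℤ) : ℝ) / 2) * r * w (Ka + 1 - 1) ≤ ϑ * w (Ka + 1 - 2) ^ 2)
    (checkA₂ : (1 + (1 : ℝ)) ^ ((5 : ℝ) * ((Ka : ℤ) : ℝ) / 2) *
      coeffAbsOn (botShifts shiftSet) (α) * c * (ν₀ * r / w (Ka - 1)) ≤ 1 / 2)
    (checkA₃ : (1 + (1 : ℝ)) ^ ((5 : ℝ) * ((Ka + 1 : ℤ) : ℝ) / 2) *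
      coeffAbsOn (botShifts shiftSet) (α) * c * (ν₁ * r / w Ka) ≤ 1 / 2)
    (checkA₄ : 2 * (Real.sqrt 2 * Real.sqrt (4 / 3 * (4 : ℕ) * (25 / 32)) / (2 * (1 + (1 : ℝ)) ^ ((Ka : ℤ) : ℝ)) +
      coeffAbsOn (botShifts shiftSet) (α) * c *
        (ϑ / (1 + (1 : ℝ)) ^ ((5 : ℝ) / 2)) * ν₀ ^ 2) ≤ ν₁)
    (checkA₅ : 2 * (Real.sqrt 2 * Real.sqrt (4 / 3 * (4 : ℕ) * (25 / 32)) / (2 * (1 + (1 : ℝ)) ^ ((Ka + 1 : ℤ) : ℝ)) +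
      coeffAbsOn (botShifts shiftSet) (α) * c *
        (ϑ / (1 + (1 : ℝ)) ^ ((5 : ℝ) / 2)) * ν₁ ^ 2) ≤ ν₁)
    (checkA₆ : ν₁ * (1 + (1 : ℝ)) ^ θ₀ ≤ ρ)
    -- the certificate's interior, trapping and landing clauses
    (hinside : ∀ (z S₀ : Fin 4 → ℤ → ℝ), Core z →
      (∀ i k, -Kb ≤ k → k ≤ Ka → w k * |S₀ i k - z i k| ≤ r) → ∀ i k, -Kb ≤ k → k ≤ Ka → |S₀ i k| < M k)
    -- the BRANCH CERTIFICATE (glue X-c): start boxes covering the fattened core, rough enclosures up to the clock `c`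
    -- inside the open `M`-box, section sign at `tlo b` / `thi b`, static readout at the states reached on the section
    {ι : Type*} {Box Hull : ι → (Fin 4 → ℤ → ℝ) → Prop} {sec : (Fin 4 → ℤ → ℝ) → ℝ} {lev : ℝ} {tlo thi : ι → ℝ}
    (hcover : ∀ (z S₀ : Fin 4 → ℤ → ℝ), Core z →
      (∀ i k, -Kb ≤ k → k ≤ Ka → w k * |S₀ i k - z i k| ≤ r) → ∃ b, Box b S₀)
    (henc : ∀ (b : ι) (s : ℝ) (S : Fin 4 → ℤ → ℝ → ℝ), 0 < s → s ≤ c → Box b (slice S 0) →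
      WindowRun shiftSet 1 α Kb Ka (Zf (-Kb - 1)) (ν (Ka + 1) * r / w Ka) s S →
      (∀ i k, -Kb ≤ k → k ≤ Ka → ∀ u ∈ Icc 0 s, |S i k u| ≤ M k) → ∀ u ∈ Icc 0 s, Hull b (slice S u))
    (hhull : ∀ b y, Hull b y → ∀ i k, -Kb ≤ k → k ≤ Ka → |y i k| < M k)
    (hwin : ∀ b, 0 < tlo b ∧ tlo b ≤ thi b ∧ thi b ≤ c₀)
    (hsec : ∀ (s : ℝ) (S : Fin 4 → ℤ → ℝ → ℝ), WindowRun shiftSet 1 α Kb Ka (Zf (-Kb - 1)) (ν (Ka + 1) * r / w Ka) s S →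
      ContinuousOn (fun u => sec (slice S u)) (Icc 0 s))
    (hbefore : ∀ (b : ι) (S : Fin 4 → ℤ → ℝ → ℝ), Box b (slice S 0) →
      WindowRun shiftSet 1 α Kb Ka (Zf (-Kb - 1)) (ν (Ka + 1) * r / w Ka) (tlo b) S →
      (∀ i k, -Kb ≤ k → k ≤ Ka → ∀ u ∈ Icc 0 (tlo b), |S i k u| ≤ M k) → sec (slice S (tlo b)) < lev)
    (hafter : ∀ (b : ι) (S : Fin 4 → ℤ → ℝ → ℝ), Box b (slice S 0) →
      WindowRun shiftSet 1 α Kb Ka (Zf (-Kb - 1)) (ν (Ka + 1) * r / w Ka) (thi b) S →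
      (∀ i k, -Kb ≤ k → k ≤ Ka → ∀ u ∈ Icc 0 (thi b), |S i k u| ≤ M k) → lev ≤ sec (slice S (thi b)))
    (hread : ∀ (b : ι) (s : ℝ) (S : Fin 4 → ℤ → ℝ → ℝ), tlo b ≤ s → s ≤ thi b → Box b (slice S 0) →
      WindowRun shiftSet 1 α Kb Ka (Zf (-Kb - 1)) (ν (Ka + 1) * r / w Ka) s S →
      (∀ i k, -Kb ≤ k → k ≤ Ka → ∀ u ∈ Icc 0 s, |S i k u| ≤ M k) → sec (slice S s) = lev →
      ∃ (a : ℝ) (z' : Fin 4 → ℤ → ℝ), 0 < a ∧ (1 + (1 : ℝ)) ^ (-θ₀) ≤ a ∧ (1 + σ) * a ≤ |S i₀ 1 s| ∧ Core z' ∧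
        (∀ i k, -Kb ≤ k → k + 1 ≤ Ka → w k * |S i (1 + k) s / a - z' i k| ≤ ρ * r) ∧
        (∀ (i : Fin 4) (v : ℝ), |v| ≤ ν (Ka + 1) * r / w Ka → w Ka * |v / a - z' i Ka| ≤ ρ * r) ∧
        (∀ i, |S i (-Kb) s| ≤ a * Zb (-Kb - 1))) :
    ∃ (σ : ℝ) (i₀ : Fin 4) (α : Fin 4 → Fin 4 → Fin 4 → ℤ × ℤ × ℤ → ℝ) (X₀ : Fin 4 → ℝ) (Z : Set (Fin 4 → ℤ → ℝ))
      (w : ℤ → ℝ) (r ρ θ₀ θ c₀ c : ℝ) (env₀ : ℤ → ℝ),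
      InTableClass 64 α ∧ X₀ i₀ ≠ 0 ∧ GapData₂ σ 1 i₀ α X₀ Z w r ρ θ₀ θ c₀ c env₀ ∧
        (∀ ϑ : ℝ, 0 < ϑ → ∃ k₂ : ℤ, ∀ k : ℤ, k₂ ≤ k →
          (1 + 1) ^ ((5 : ℝ) * (k + 2) / 2) * r * w (k + 1) ≤ ϑ * w k ^ 2) := by
  have hε : (0 : ℝ) < 1 := one_pos
  have hε1 : (1 : ℝ) ≤ 1 := le_rfl
  have hr0 : 0 ≤ r := hr.le
  have hc : 0 ≤ c := by linarith
  have hC64 : (0 : ℝ) ≤ 64 := by norm_num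
  have hα1 : ∀ (i₁ i₂ i₃ : Fin 4) (μ : ℤ × ℤ × ℤ), μ ∈ shiftSet → |α i₁ i₂ i₃ μ| ≤ 1 :=
    fun i₁ i₂ i₃ μ hμ => (hα.2.2.1 i₁ i₂ i₃ μ hμ).1
  have hCα : ∀ i : Fin 4, ∑ i₁, ∑ i₂, ∑ μ ∈ shiftSet, |α i₁ i₂ i μ| ≤ 64 := by
    intro i
    refine (sum_abs_coeffOn_le (𝕊 := shiftSet) hα1 i).trans ?_
    have hcard : (shiftSet.card : ℝ) = 4 := by rw [shiftSet]; norm_num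
    rw [hcard]; norm_num
  have hCbot0 : 0 ≤ coeffAbsOn (botShifts shiftSet) α := coeffAbsOn_nonneg _ _
  have hCbotc : 0 ≤ coeffAbsOn (botShifts shiftSet) α * c := mul_nonneg hCbot0 hc
  -- wake statics (glue VIII-a)
  obtain ⟨hZfpos, hZmin', hZb0, hZbf⟩ := wake_signs (Kb := Kb) hε hCb hγ0 hr0 hCw hZb hZf hwn hKb
  have hZmin : (0 : ℝ) < 2 * Cb := by positivity
  have hcloseB := wake_closing (Kb := Kb) hε hCb hγ0 hγ1 hr0 hCw hc hC64 hZb hZf checkB₁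
  have hDmax := wake_drift (Kb := Kb) hε hCb hγ0 hγ1 hr0 hCw hc hC64 hZb hZf
  have hshiftB := wake_shift (θ₀ := θ₀) hε hCb hγ0 hγ1 hr0 hCw hc hC64 hZb hZf hwn hKb checkB₂
  have hZbt : ∀ j, j < -Kb → Zb j ≤ Cb * (1 + (1 : ℝ)) ^ (-(j : ℝ)) := fun j hj =>
    wake_tame hε hCb hγ1 hZb j (by omega)
  -- quiet statics (glue VIII-b)
  obtain ⟨hν, hνmax⟩ := quiet_signs (Ka := Ka) hνKa hνhi hν₀ hν₁
  have hthin := quiet_thin (Ka := Ka) hε hε1 hCw hb hwp hwn hKa hr0 checkA₁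
  have hslowA := quiet_slow (Ka := Ka) hε hε1 hCw hb hwp hwn (by omega) hνKa hνhi hν₁ hCbotc hr0 checkA₂
    checkA₃
  have hcloseA := quiet_closing (m := 4) (Ka := Ka) hε hνKa hνhi checkA₄ checkA₅
  have hshiftA := quiet_shift (Ka := Ka) (θ₀ := θ₀) (ρ := ρ) hνhi checkA₆
  have hMν' : M Ka ≤ ν Ka * r / w (Ka - 1) := by rw [hνKa]; exact hMν
  -- the two dynamical clauses from the branch certificate (glue X-c)
  have htrap := htrap_of_branches hcover henc hhull
  have hland := hland_of_branches (Box := Box) (i₀ := i₀) (σ := σ) (ρ := ρ) (θ₀ := θ₀) hcover hwin hsec hbefore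
    hafter hread
  obtain ⟨hgap, hthin'⟩ := gapData₂On_pgw_of_windowCertificate isNearestNeighbourSet_shiftSet
    isSlotClosed_shiftSet one_one_one_not_mem_shiftSet hε hε1 hα hC64 hCα (i₀ := i₀) (X₀ := X₀) hKb
    (by omega) hr hρ hρ1 hθ₀ hθ₀θ hθ hc₀ hc₀c hσ hMmax hcore hdatum hZfpos hZmin (fun j hj => hZmin' j hj)
    hZb0 hZbf hMZf hcloseB hDmax hshiftB hcoreTop hthin hν hνmax hcloseA hslowA hMν' hshiftA hinside htrap
    hland hCb.le hZbt hCw hb hwp hwn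
  exact ⟨σ, i₀, α, X₀, _, w, r, ρ, θ₀, θ, c₀, c, _, hα.inTableClass, hX₀, gapData₂On_shiftSet_iff.1 hgap,
    hthin'⟩

end CertificateGlueOn

end Summit.NavierStokesRegularity.NavierStokesRegularity.Theorems

end
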